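import Summits.CriticalPhenomena.PercolationContinuityZ3.Theorems.PercNearOneGluingAdditiveGluingUncenteredTransfer
import HarnessLib

/-!
# Crux `PercNearOneGluing.AdditiveGluing` (stmt-CriticalPhenomena-4576), line `tieline`:
# the kernel (T) from the covariance-transfer principle (UCT) for monotone functionals of the source cluster

Support file (`--supports stmt-CriticalPhenomena-4576`, helper, seat (d) exchange-certificate form, gen 10).  No definitions,
no named facts, no sorries (the two `notation3`s are the source abbreviations of `…OffClusterAssociation.lean`).

Setting: `μ = prodBernoulli w` on `Fin n`, roles `o, b, u, v, c`, `D = {u ↮ v}`, `N = {c ↮ u} ∩ {c ↮ v}`.  The **covariance-transfer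
principle** (UCT, lead c9 `Ideas/uct-covariance-transfer.md`, restricted to functionals of the cluster of `v`) is the statement:
for every function `F` of the open (edge) cluster `C_v` of `v` that is monotone for inclusion,

  `μ(N) · ( μ(D) ∫_{D ∩ {v↔o}} F(C_v) dμ − (∫_D F(C_v) dμ) μ(D ∩ {v↔o}) )
     ≥ μ(N ∩ {o↔c}) · ( μ(D) ∫_{D ∩ {v↔c}} F(C_v) dμ − (∫_D F(C_v) dμ) μ(D ∩ {v↔c}) )`,

i.e. `Cov(F(C_v), 1{v↔o} | u↮v) ≥ P(o↔c | c↮u, c↮v) · Cov(F(C_v), 1{v↔c} | u↮v)` (denominator-free).  THIS FILE PROVES: UCT (for all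
`n, w, v, u, o, c` and all monotone `F`) implies the registered kernel (T) = `stub_k0CovTransferQ_c9` (statement verbatim), by taking
`F(C) = − P(u ↔ b off C̄)` (monotone: the off-cluster connection probability is antitone in the cluster, `UncenteredTransfer.offConn_anti`)
and van den Berg–Häggström–Kahn's display (10) (`UncenteredTransfer.real_inter_conn_eq_sum`: given `C_v`, the edges off `C̄_v` are fresh, so
`∫_{D ∩ {v↔x}} P(u↔b off C̄_v) dμ = μ(D ∩ {v↔x} ∩ {u↔b})`).  A complete paper proof of UCT itself (telescoping along the BHK heat-bath chain,
vertex elimination with FKG, and Gladkov's decision-tree Harris inequality) is in the seat memo EXCHCERT-g10 / PROOF-UCT attached to the item;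
this bridge fixes the exact Lean form of UCT that closes the stub.
[cite: VandenbergHaggstromKahn2005, §1 pp. 7–8, display (10) — corollary]
-/

namespace Summit.CriticalPhenomena.PercolationContinuityZ3.Cruxes.AdditiveGluing.TieLine

open MeasureTheory Set
open Literature.Probability.LatticeModels (prodBernoulli)
open Literature.Probability.Percolation
open Literature.Probability.Percolation.BHK2006
open Literature.Probability.Percolation.DecisionTree (ind ind_of_mem ind_of_not_mem ind_nonneg)

noncomputable section
open scoped Classical

local notation3 (prettyPrint := false) "D⟦" s ", " X "⟧" => {ω | ∀ x ∈ X, ¬ (openGraph ω).Reachable s x}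
local notation3 (prettyPrint := false) "B⟦" W ", " s "⟧" => {e | ∃ v ∈ e, v = s ∨ ∃ e' ∈ W, v ∈ e'}

namespace UCTBridge

open UncenteredTransfer

variable {V : Type*} [Fintype V] (w : Sym2 V → unitInterval)

/-- **Display (10) for the integral of the off-cluster connection weight.**  For `D = {v ↮ u}` and a predicate `R` of the cluster `C_v`:
`∫_{D ∩ {R(C_v)}} (−P(u ↔ b off C̄_v)) dμ = − μ(D ∩ {R(C_v)} ∩ {u ↔ b})`. [cite: VandenbergHaggstromKahn2005, §1 pp. 7–8, (10) — corollary] -/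
theorem setIntegral_negOff_eq (v u b : V) (R : Set (Sym2 V) → Prop) :
    ∫ ω in D⟦v, ({u} : Set V)⟧ ∩ {ω | R (openEdgeCluster ω v)},
        -(∑ η : Set (Sym2 V), weight (fun e => (w e : ℝ)) η *
          (if (openGraph (η \ B⟦openEdgeCluster ω v, v⟧)).Reachable u b then (1 : ℝ) else 0)) ∂(prodBernoulli w) =
      -(prodBernoulli w).real (D⟦v, ({u} : Set V)⟧ ∩ {ω | R (openEdgeCluster ω v)} ∩ openConn u b) := by
  rw [setIntegral_eq_sum, real_inter_conn_eq_sum w v u b R, ← Finset.sum_neg_distrib]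
  refine Finset.sum_congr rfl fun ω _ => ?_
  have hsum : ∑ η : Set (Sym2 V), weight (fun e => (w e : ℝ)) η *
      ((if R (openEdgeCluster ω v) then (1 : ℝ) else 0) *
        (if (openGraph (η \ B⟦openEdgeCluster ω v, v⟧)).Reachable u b then (1 : ℝ) else 0)) =
      (if R (openEdgeCluster ω v) then (1 : ℝ) else 0) *
        ∑ η : Set (Sym2 V), weight (fun e => (w e : ℝ)) η *
          (if (openGraph (η \ B⟦openEdgeCluster ω v, v⟧)).Reachable u b then (1 : ℝ) else 0) := by
    rw [Finset.mul_sum]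
    refine Finset.sum_congr rfl fun η _ => ?_
    ring
  rw [hsum, UncenteredTransfer.ind_inter, ind_setOf_eq R ω]
  ring

omit [Fintype V] in
/-- `{v ↮ u} ∩ {True} = {v ↮ u}`. [folklore] -/
theorem setId_DT (v u : V) :
    D⟦v, ({u} : Set V)⟧ ∩ {ω | (fun _ : Set (Sym2 V) => True) (openEdgeCluster ω v)} = (openConn v u)ᶜ := by
  have h : {ω : Set (Sym2 V) | (fun _ : Set (Sym2 V) => True) (openEdgeCluster ω v)} = Set.univ := by
    ext ω; simp
  rw [h, Set.inter_univ]
  exact setId_N v u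

/-- The functional `C ↦ −P(u ↔ b off C̄)` is monotone in the cluster `C`. [cite: VandenbergHaggstromKahn2005, §1 p. 7 (the conditional
distribution of `C_t` given `C_s = W` is stochastically decreasing in `W`) — corollary] -/
theorem monotone_negOff (v u b : V) :
    Monotone fun W : Set (Sym2 V) =>
      -(∑ η : Set (Sym2 V), weight (fun e => (w e : ℝ)) η * (if (openGraph (η \ B⟦W, v⟧)).Reachable u b then (1 : ℝ) else 0)) :=
  fun _ _ hWW' => neg_le_neg (offConn_anti w v u b hWW')

/-- Display (10) at the event `{v ↔ x}`: `∫_{{u↮v} ∩ {v↔x}} (−P(u↔b off C̄_v)) dμ = −μ({u↮v} ∩ {v↔x} ∩ {u↔b})`.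
[cite: VandenbergHaggstromKahn2005, §1 pp. 7–8, (10) — corollary] -/
theorem setIntegral_negOff_conn (v u b x : V) :
    ∫ ω in ((openConn u v)ᶜ ∩ openConn v x : Set (BondConfig V)),
        -(∑ η : Set (Sym2 V), weight (fun e => (w e : ℝ)) η *
          (if (openGraph (η \ B⟦openEdgeCluster ω v, v⟧)).Reachable u b then (1 : ℝ) else 0)) ∂(prodBernoulli w) =
      -(prodBernoulli w).real ((openConn u v)ᶜ ∩ openConn v x ∩ openConn u b : Set (BondConfig V)) := by
  have hcomm : (openConn u v : Set (BondConfig V)) = openConn v u := by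
    ext ω; exact ⟨fun h => SimpleGraph.Reachable.symm h, fun h => SimpleGraph.Reachable.symm h⟩
  have h1 : ((openConn u v)ᶜ ∩ openConn v x : Set (BondConfig V)) =
      D⟦v, ({u} : Set V)⟧ ∩ {ω | x = v ∨ ∃ e ∈ openEdgeCluster ω v, x ∈ e} := by
    rw [hcomm]; exact (setId_O v u x).symm
  rw [h1]
  exact setIntegral_negOff_eq w v u b (fun C : Set (Sym2 V) => x = v ∨ ∃ e ∈ C, x ∈ e)

/-- Display (10) on all of `{u ↮ v}`: `∫_{{u↮v}} (−P(u↔b off C̄_v)) dμ = −μ({u↮v} ∩ {u↔b})`.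
[cite: VandenbergHaggstromKahn2005, §1 pp. 7–8, (10) — corollary] -/
theorem setIntegral_negOff_all (v u b : V) :
    ∫ ω in ((openConn u v)ᶜ : Set (BondConfig V)),
        -(∑ η : Set (Sym2 V), weight (fun e => (w e : ℝ)) η *
          (if (openGraph (η \ B⟦openEdgeCluster ω v, v⟧)).Reachable u b then (1 : ℝ) else 0)) ∂(prodBernoulli w) =
      -(prodBernoulli w).real ((openConn u v)ᶜ ∩ openConn u b : Set (BondConfig V)) := by
  have hcomm : (openConn u v : Set (BondConfig V)) = openConn v u := by
    ext ω; exact ⟨fun h => SimpleGraph.Reachable.symm h, fun h => SimpleGraph.Reachable.symm h⟩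
  have h2 := setIntegral_negOff_eq w v u b (fun _ : Set (Sym2 V) => True)
  rw [setId_DT v u, ← hcomm] at h2
  exact h2

/-- **(UCT) at the roles `(v, u, o, c)` for all monotone functionals of `C_v` ⟹ (T) at `(o, b, u, v, c)`** (general finite vertex type).
[cite: VandenbergHaggstromKahn2005, §1 pp. 7–8, display (10) — corollary] -/
theorem covTransferQ_of_uct_at (v u o c b : V)
    (hUCT : ∀ F : Set (Sym2 V) → ℝ, Monotone F →
      (prodBernoulli w).real ((openConn c u)ᶜ ∩ (openConn c v)ᶜ ∩ openConn o c : Set (BondConfig V)) *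
          ((prodBernoulli w).real ((openConn u v)ᶜ : Set (BondConfig V)) *
              (∫ ω in ((openConn u v)ᶜ ∩ openConn v c : Set (BondConfig V)), F (openEdgeCluster ω v) ∂(prodBernoulli w)) -
            (∫ ω in ((openConn u v)ᶜ : Set (BondConfig V)), F (openEdgeCluster ω v) ∂(prodBernoulli w)) *
              (prodBernoulli w).real ((openConn u v)ᶜ ∩ openConn v c : Set (BondConfig V))) ≤
        (prodBernoulli w).real ((openConn c u)ᶜ ∩ (openConn c v)ᶜ : Set (BondConfig V)) *
          ((prodBernoulli w).real ((openConn u v)ᶜ : Set (BondConfig V)) *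
              (∫ ω in ((openConn u v)ᶜ ∩ openConn v o : Set (BondConfig V)), F (openEdgeCluster ω v) ∂(prodBernoulli w)) -
            (∫ ω in ((openConn u v)ᶜ : Set (BondConfig V)), F (openEdgeCluster ω v) ∂(prodBernoulli w)) *
              (prodBernoulli w).real ((openConn u v)ᶜ ∩ openConn v o : Set (BondConfig V)))) :
    (prodBernoulli w).real ((openConn u v)ᶜ : Set (BondConfig V)) *
        ((prodBernoulli w).real ((openConn u v)ᶜ ∩ openConn u b ∩ openConn v o : Set (BondConfig V)) *
            (prodBernoulli w).real ((openConn c u)ᶜ ∩ (openConn c v)ᶜ : Set (BondConfig V)) -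
          (prodBernoulli w).real ((openConn u v)ᶜ ∩ openConn u b ∩ openConn v c : Set (BondConfig V)) *
            (prodBernoulli w).real ((openConn c u)ᶜ ∩ (openConn c v)ᶜ ∩ openConn o c : Set (BondConfig V))) ≤
      (prodBernoulli w).real ((openConn u v)ᶜ ∩ openConn u b : Set (BondConfig V)) *
        ((prodBernoulli w).real ((openConn u v)ᶜ ∩ openConn v o : Set (BondConfig V)) *
            (prodBernoulli w).real ((openConn c u)ᶜ ∩ (openConn c v)ᶜ : Set (BondConfig V)) -
          (prodBernoulli w).real ((openConn u v)ᶜ ∩ openConn v c : Set (BondConfig V)) *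
            (prodBernoulli w).real ((openConn c u)ᶜ ∩ (openConn c v)ᶜ ∩ openConn o c : Set (BondConfig V))) := by
  -- UCT for the monotone functional `F(C) = −P(u ↔ b off C̄)`
  have key := hUCT _ (monotone_negOff w v u b)
  beta_reduce at key
  rw [setIntegral_negOff_conn w v u b c, setIntegral_negOff_conn w v u b o, setIntegral_negOff_all w v u b] at key
  -- reorder the intersections to the stub's form
  have hso : ((openConn u v)ᶜ ∩ openConn v o ∩ openConn u b : Set (BondConfig V)) =
      (openConn u v)ᶜ ∩ openConn u b ∩ openConn v o := Set.inter_right_comm _ _ _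
  have hsc : ((openConn u v)ᶜ ∩ openConn v c ∩ openConn u b : Set (BondConfig V)) =
      (openConn u v)ᶜ ∩ openConn u b ∩ openConn v c := Set.inter_right_comm _ _ _
  rw [hso, hsc] at key
  -- linear rearrangement
  set mN := (prodBernoulli w).real ((openConn c u)ᶜ ∩ (openConn c v)ᶜ : Set (BondConfig V))
  set mNoc := (prodBernoulli w).real ((openConn c u)ᶜ ∩ (openConn c v)ᶜ ∩ openConn o c : Set (BondConfig V))
  set mD := (prodBernoulli w).real ((openConn u v)ᶜ : Set (BondConfig V))
  set mDub := (prodBernoulli w).real ((openConn u v)ᶜ ∩ openConn u b : Set (BondConfig V))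
  set mDvo := (prodBernoulli w).real ((openConn u v)ᶜ ∩ openConn v o : Set (BondConfig V))
  set mDvc := (prodBernoulli w).real ((openConn u v)ᶜ ∩ openConn v c : Set (BondConfig V))
  set ao := (prodBernoulli w).real ((openConn u v)ᶜ ∩ openConn u b ∩ openConn v o : Set (BondConfig V))
  set ac := (prodBernoulli w).real ((openConn u v)ᶜ ∩ openConn u b ∩ openConn v c : Set (BondConfig V))
  have hid : mD * (ao * mN - ac * mNoc) - mDub * (mDvo * mN - mDvc * mNoc) =
      mNoc * (mD * (-ac) - (-mDub) * mDvc) - mN * (mD * (-ao) - (-mDub) * mDvo) := by ring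
  linarith [key, hid]

/-- **(UCT) for monotone functionals of `C_v` ⟹ the kernel (T) = `stub_k0CovTransferQ_c9` (verbatim statement).**
The hypothesis is the covariance-transfer principle in denominator-free form: with `D = {u ↮ v}`, `N = {c ↮ u} ∩ {c ↮ v}`,
`μ(N)·(μ(D)·∫_{D∩{v↔o}} F − (∫_D F)·μ(D∩{v↔o})) ≥ μ(N∩{o↔c})·(μ(D)·∫_{D∩{v↔c}} F − (∫_D F)·μ(D∩{v↔c}))` for every monotone `F` of
`C_v` (all `n`, weights and roles); the conclusion is its instance `F = −P(u↔b off C̄_v)`, rewritten with display (10).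
[cite: VandenbergHaggstromKahn2005, §1 pp. 7–8, display (10) — corollary] -/
theorem covTransferQ_of_uct
    (hUCT : ∀ (n : ℕ) (w : Sym2 (Fin n) → unitInterval) (v u o c : Fin n) (F : Set (Sym2 (Fin n)) → ℝ), Monotone F →
      (prodBernoulli w).real ((openConn c u)ᶜ ∩ (openConn c v)ᶜ ∩ openConn o c : Set (BondConfig (Fin n))) *
          ((prodBernoulli w).real ((openConn u v)ᶜ : Set (BondConfig (Fin n))) *
              (∫ ω in ((openConn u v)ᶜ ∩ openConn v c : Set (BondConfig (Fin n))), F (openEdgeCluster ω v) ∂(prodBernoulli w)) -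
            (∫ ω in ((openConn u v)ᶜ : Set (BondConfig (Fin n))), F (openEdgeCluster ω v) ∂(prodBernoulli w)) *
              (prodBernoulli w).real ((openConn u v)ᶜ ∩ openConn v c : Set (BondConfig (Fin n)))) ≤
        (prodBernoulli w).real ((openConn c u)ᶜ ∩ (openConn c v)ᶜ : Set (BondConfig (Fin n))) *
          ((prodBernoulli w).real ((openConn u v)ᶜ : Set (BondConfig (Fin n))) *
              (∫ ω in ((openConn u v)ᶜ ∩ openConn v o : Set (BondConfig (Fin n))), F (openEdgeCluster ω v) ∂(prodBernoulli w)) -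
            (∫ ω in ((openConn u v)ᶜ : Set (BondConfig (Fin n))), F (openEdgeCluster ω v) ∂(prodBernoulli w)) *
              (prodBernoulli w).real ((openConn u v)ᶜ ∩ openConn v o : Set (BondConfig (Fin n))))) :
    ∀ (n : ℕ) (w : Sym2 (Fin n) → unitInterval) (o b u v c : Fin n),
      (Literature.Probability.LatticeModels.prodBernoulli w).real
          ((Literature.Probability.Percolation.openConn u v)ᶜ : Set (Literature.Probability.Percolation.BondConfig (Fin n))) *
        ((Literature.Probability.LatticeModels.prodBernoulli w).real
            ((Literature.Probability.Percolation.openConn u v)ᶜ ∩ Literature.Probability.Percolation.openConn u b ∩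
              Literature.Probability.Percolation.openConn v o : Set (Literature.Probability.Percolation.BondConfig (Fin n))) *
          (Literature.Probability.LatticeModels.prodBernoulli w).real
            ((Literature.Probability.Percolation.openConn c u)ᶜ ∩ (Literature.Probability.Percolation.openConn c v)ᶜ :
              Set (Literature.Probability.Percolation.BondConfig (Fin n))) -
          (Literature.Probability.LatticeModels.prodBernoulli w).real
            ((Literature.Probability.Percolation.openConn u v)ᶜ ∩ Literature.Probability.Percolation.openConn u b ∩
              Literature.Probability.Percolation.openConn v c : Set (Literature.Probability.Percolation.BondConfig (Fin n))) *
          (Literature.Probability.LatticeModels.prodBernoulli w).real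
            ((Literature.Probability.Percolation.openConn c u)ᶜ ∩ (Literature.Probability.Percolation.openConn c v)ᶜ ∩
              Literature.Probability.Percolation.openConn o c : Set (Literature.Probability.Percolation.BondConfig (Fin n)))) ≤
      (Literature.Probability.LatticeModels.prodBernoulli w).real
          ((Literature.Probability.Percolation.openConn u v)ᶜ ∩ Literature.Probability.Percolation.openConn u b :
            Set (Literature.Probability.Percolation.BondConfig (Fin n))) *
        ((Literature.Probability.LatticeModels.prodBernoulli w).real
            ((Literature.Probability.Percolation.openConn u v)ᶜ ∩ Literature.Probability.Percolation.openConn v o :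
              Set (Literature.Probability.Percolation.BondConfig (Fin n))) *
          (Literature.Probability.LatticeModels.prodBernoulli w).real
            ((Literature.Probability.Percolation.openConn c u)ᶜ ∩ (Literature.Probability.Percolation.openConn c v)ᶜ :
              Set (Literature.Probability.Percolation.BondConfig (Fin n))) -
          (Literature.Probability.LatticeModels.prodBernoulli w).real
            ((Literature.Probability.Percolation.openConn u v)ᶜ ∩ Literature.Probability.Percolation.openConn v c :
              Set (Literature.Probability.Percolation.BondConfig (Fin n))) *
          (Literature.Probability.LatticeModels.prodBernoulli w).real
            ((Literature.Probability.Percolation.openConn c u)ᶜ ∩ (Literature.Probability.Percolation.openConn c v)ᶜ ∩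
              Literature.Probability.Percolation.openConn o c : Set (Literature.Probability.Percolation.BondConfig (Fin n)))) :=
  fun n w o b u v c => covTransferQ_of_uct_at w v u o c b (hUCT n w v u o c)

end UCTBridge

end

end Summit.CriticalPhenomena.PercolationContinuityZ3.Cruxes.AdditiveGluing.TieLine
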